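import Summits.HodgeConjecture.HodgeConjecture.Theorems.Ring2HypothesesDescentAlgebraicQuasiInverse
import Summits.HodgeConjecture.HodgeConjecture.Theorems.Ring2AbelianAllAndreFibreClassConstancyHolds
import Summits.HodgeConjecture.HodgeConjecture.Theorems.Ring2AbelianAllAndreLerayIdempotentRational
import HarnessLib

/-!
# Ring 2 hypotheses, descent face — THE β-COLUMN OF SUB-CELL AbelianAll WITH NO SUPPLY NODE: `(5) ⟹ (β′)`, `(5∀) ⟹ (β∀′)`,
# `(5)_d ⟹ (β′)_d`, the Leray idempotents and the Tankeev rung `d = 2`, now that (Q), (κ), (φ) are all theorems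

research route conditional on HC_CM; not a corollary; Q11.4-sentence-2 already refuted in dim ≥ 3.
Cell `pub-hodge-ring2` (Hodge ladder STAGE 3), seat `ring2-b05` (binder row b05
`Ring2.Hypotheses.MotivatedImpliesAlgebraicAV`, «published modulo X», X = `(5∀)`/`(5)` = `B` for the total spaces of
compact abelian pencils), gen 42. `HC_CM` does not occur in this file; no node is discharged: `(5∀) LefschetzBCompactPencils`,
`(5) LefschetzBCMPointedPencils`, `(5)_d`, `(β…)` and Tankeev's `h_T` are HYPOTHESES wherever they appear.

The edge `(5) ⟹ (β′)` (REFEREE-AB R-09/R-10 test case; ab-andre-1 parts XI–XIII) was kernel modulo three print-true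
supply nodes: (Q) `AlgebraicQuasiInverseOfLefschetzStandard`, (κ) `FibreGysinKernelCompactPencils`, (φ)
`FibreClassConstantCompactPencils`. (κ) and (φ) became theorems with ab-andre-2's parts XII-e / XIII-e–f
(`fibreGysinKernelCompactPencils_holds`, `fibreClassConstantCompactPencils_holds`); (Q) with the companion
`…AlgebraicQuasiInverse` (gen 42, `algebraicQuasiInverseOfLefschetzStandard_holds`). This file feeds the three closed
terms into ab-andre-1's part XI rows BY NAME — every statement below is a part-XI / part-XXVII statement with ALL supply
binders deleted; what remains displayed is exactly the `B`-type input (`B(𝒳)` per pencil, `(5∀)`, `(5)`, `(5)_d`, or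
Tankeev's named fact `h_T`):

* §1 per pencil, from `B(𝒳)` alone: the algebraic quasi-inverse of `L_t = j_{t*} j_t^*`
  (`exists_algebraic_quasiInverse_fiberGysin_of_lefschetzB`), (β′ᵖᵗ_f), (A_f), (β′_f), and the algebraic Leray
  idempotent with (Π1), (π), (κ) in every degree `2p ≤ 2d` (`exists_lerayIdempotentC_of_lefschetzB`).
* §2 node level, NO supply binder: **`(5∀) ⟹ (β∀′ᵖᵗ)`, `(5∀) ⟹ (β∀′)`, `(5) ⟹ (β′ᵖᵗ)`, `(5) ⟹ (β′)`** (dot-notation on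
  the nodes: `LefschetzBCompactPencils.fibreClassLefschetzOnCompactPencils` etc.), graded `(5)_d ⟹ (β′)_d`,
  `(5∀)_d ⟹ (β′)_d`.
* §3 **THE RUNG `d = 2` FROM TANKEEV 2011 ALONE**: `h_T ⟹ (β′)_2` (`fibreClassLefschetzOnAtRelDim_two_of_tankeev`) — on
  every compact pencil of abelian SURFACES the cup product with the fibre class has an ALGEBRAIC quasi-inverse, granted
  only the Literature named fact `Tankeev2011_lefschetzStandard_abelianSurfacePencilThreefold` (`B` for these threefolds,
  a theorem in print); `(β′)_d` for all `d ≤ 2`; `(β′) ↔ ∀ d ≥ 3, (β′)_d` modulo `h_T`.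
* §4 the edge table `lefschetzB_to_fibreClass_chain_closed` — part XI's `lefschetzB_to_fibreClass_chain` with its three
  supply binders gone (RING2-MAP labels `K[Q; κ, φ]` → `K`).

No definition, no named fact, no sorry. References: Andre1996Motifs (Prop. 3.3 pp. 21–22, Lemme 6.3.1 p. 31, §6.3
Remarque 2 p. 33), Abdulali1994FamiliesAV (Conj. 5.3, Rem. 5.4, Thm. 5.5, p. 1130), DeligneHodgeII1971 (Thm. 4.1.1,
4.2.6), VoisinHodgeII2003 (§4.3.1 Thm. 4.18), Fulton1998 (§19.1 Prop. 19.1.1), Tankeev2011 (main theorem),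
Tankeev2020 (Introduction), GreenMurreVoisin1994 (Murre §7.7).
-/

noncomputable section

-- every declaration of this problem lives in `Summit.HodgeConjecture.HodgeConjecture.…` (summit = sub-problem)
set_option linter.dupNamespace false

namespace Summit.HodgeConjecture.HodgeConjecture.Ring2.AbelianAll

open CategoryTheory AlgebraicGeometry MonoidalCategory
open Literature.AlgebraicGeometry Literature.AlgebraicGeometry.Motives
open Literature.AlgebraicGeometry.HodgeTheory
open Literature.AlgebraicGeometry.Tankeev2011 (Tankeev2011_lefschetzStandard_abelianSurfacePencilThreefold)
open Summit.HodgeConjecture.HodgeConjecture.Theorems (algebraicQuasiInverseOfLefschetzStandard_holds)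

variable {𝒳 S : SchemeOver ℂ}

/-! ## §1 Per pencil: everything from `B(𝒳)` alone -/

/-- **`B(𝒳) ⟹` for each `t` and every `p ≤ d` the operator `L_t = j_{t*} j_t^*` on `H²ᵖ(𝒳)` has a quasi-inverse INDUCED
BY AN ALGEBRAIC CLASS on `𝒳 × 𝒳`** — part XI's `exists_algebraic_quasiInverse_fiberGysin_of_standardConjectureBStar` with
(Q) supplied by the companion's theorem. [cite: Andre1996Motifs, Prop. 3.3 (pp. 21–22) and §6.3 Remarque 2 (p. 33)]
[cite: Abdulali1994FamiliesAV, Remark 5.4 and Theorem 5.5 (p. 1130)] -/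
theorem exists_algebraic_quasiInverse_fiberGysin_of_lefschetzB {d : ℕ} {f : 𝒳 ⟶ S} (hf : IsCompactAbelianPencil f d)
    (hB : ∀ η : complexBetti 𝒳 2, StandardConjectureBStar (d + 1) 𝒳 η) {p : ℕ} (hp : p ≤ d) (t : ComplexPoints S) :
    ∃ T : complexBetti 𝒳 (2 * (p + 1)) →ₗ[ℂ] complexBetti 𝒳 (2 * p),
      IsAlgebraicCorrespondence (d + 1) (d + 1) 𝒳 𝒳 T ∧
        ∀ W : complexBetti 𝒳 (2 * p),
          fiberGysin hf t p (complexBetti.map (fiberι f t) (2 * p)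
            (T (fiberGysin hf t p (complexBetti.map (fiberι f t) (2 * p) W)))) =
            fiberGysin hf t p (complexBetti.map (fiberι f t) (2 * p) W) :=
  exists_algebraic_quasiInverse_fiberGysin_of_standardConjectureBStar hf algebraicQuasiInverseOfLefschetzStandard_holds
    hB hp t

/-- **`B(𝒳) ⟹ (β′ᵖᵗ_f)`** — part XI's row with (Q) and (κ) theorems. [cite: Andre1996Motifs, §6.3 Remarque 2 (p. 33)]
[cite: DeligneHodgeII1971, Thm. 4.1.1 and 4.2.6] -/
theorem fibreClassLefschetzPointwiseOn_of_lefschetzB {d : ℕ} {f : 𝒳 ⟶ S} (hf : IsCompactAbelianPencil f d)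
    (hB : ∀ η : complexBetti 𝒳 2, StandardConjectureBStar (d + 1) 𝒳 η) : FibreClassLefschetzPointwiseOn hf :=
  fibreClassLefschetzPointwiseOn_of_standardConjectureBStar hf algebraicQuasiInverseOfLefschetzStandard_holds
    (fibreGysinKernelOn_holds hf) hB

/-- **`B(𝒳) ⟹ (A_f)`**: the cup product with the fibre class has ONE algebraic quasi-inverse serving every fibre — part
XI's row with (Q) and (φ) theorems. [cite: Andre1996Motifs, Prop. 3.3 (pp. 21–22) and §6.3 Remarque 2 (p. 33)]
[cite: Fulton1998, §19.1 proof of Prop. 19.1.1] -/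
theorem algebraicFibreClassQuasiInverseOn_of_lefschetzB {d : ℕ} {f : 𝒳 ⟶ S} (hf : IsCompactAbelianPencil f d)
    (hB : ∀ η : complexBetti 𝒳 2, StandardConjectureBStar (d + 1) 𝒳 η) : AlgebraicFibreClassQuasiInverseOn hf :=
  algebraicFibreClassQuasiInverseOn_of_standardConjectureBStar hf algebraicQuasiInverseOfLefschetzStandard_holds
    (fibreClassConstantCompactPencils_holds hf) hB

/-- **`B(𝒳) ⟹ (β′_f)`** — Abdulali's Conjecture 5.3 in its repaired typed form for ONE compact pencil of abelian varieties
follows from conjecture `B` for its total space, in the kernel, no supply node (part XI's row with (Q), (κ), (φ) theorems).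
[cite: Abdulali1994FamiliesAV, Conjecture 5.3 and Theorem 5.5 (p. 1130)] [cite: Andre1996Motifs, §6.3 Remarque 2 (p. 33)] -/
theorem fibreClassLefschetzOn_of_lefschetzB {d : ℕ} {f : 𝒳 ⟶ S} (hf : IsCompactAbelianPencil f d)
    (hB : ∀ η : complexBetti 𝒳 2, StandardConjectureBStar (d + 1) 𝒳 η) : FibreClassLefschetzOn hf :=
  fibreClassLefschetzOn_of_standardConjectureBStar hf algebraicQuasiInverseOfLefschetzStandard_holds
    (fibreGysinKernelOn_holds hf) (fibreClassConstantCompactPencils_holds hf) hB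

/-- **`B(𝒳) ⟹` an ALGEBRAIC Leray idempotent with (Π1), (π), (κ) in every degree `2p ≤ 2d`, at every point** — part
XXVII's `exists_lerayIdempotentC_of_quasiInverse_of_standardConjectureBStar` with (Q) a theorem.
[cite: Andre1996Motifs, Prop. 3.3 (pp. 21–22) and Remarque 2 (p. 33)] [cite: DeligneHodgeII1971, Thm. 4.1.1] -/
theorem exists_lerayIdempotentC_of_lefschetzB {d : ℕ} {f : 𝒳 ⟶ S} (hf : IsCompactAbelianPencil f d)
    (hB : ∀ η : complexBetti 𝒳 2, StandardConjectureBStar (d + 1) 𝒳 η) (t : ComplexPoints S) {p : ℕ} (hp : p ≤ d) :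
    ∃ e : complexBetti 𝒳 (2 * p) →ₗ[ℂ] complexBetti 𝒳 (2 * p),
      IsAlgebraicCorrespondence (d + 1) (d + 1) 𝒳 𝒳 e ∧
      (∀ w, complexBetti.map (fiberι f t) (2 * p) (e w) = complexBetti.map (fiberι f t) (2 * p) w) ∧
      (∀ w, complexBetti.map (fiberι f t) (2 * p) w = 0 → e w = 0) :=
  exists_lerayIdempotentC_of_quasiInverse_of_standardConjectureBStar hf algebraicQuasiInverseOfLefschetzStandard_holds hB
    t hp

/-! ## §2 Node level: the β-column edges with no supply binder -/

/-- **`(5∀) ⟹ (β∀′ᵖᵗ)`, kernel, no supply node.** [cite: Andre1996Motifs, §6.3 Remarque 2 (p. 33)]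
[cite: DeligneHodgeII1971, Thm. 4.1.1 and 4.2.6] -/
theorem LefschetzBCompactPencils.fibreClassLefschetzPointwiseCompactPencils (h₅ : LefschetzBCompactPencils) :
    FibreClassLefschetzPointwiseCompactPencils :=
  fibreClassLefschetzPointwiseCompactPencils_of_lefschetzBCompactPencils algebraicQuasiInverseOfLefschetzStandard_holds
    fibreGysinKernelCompactPencils_holds h₅

/-- **`(5∀) ⟹ (β∀′)`, kernel, no supply node.** [cite: Andre1996Motifs, §6.3 Remarque 2 (p. 33)]
[cite: Abdulali1994FamiliesAV, Theorem 5.5 (p. 1130)] -/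
theorem LefschetzBCompactPencils.fibreClassLefschetzOnCompactPencils (h₅ : LefschetzBCompactPencils) :
    FibreClassLefschetzOnCompactPencils :=
  fibreClassLefschetzOnCompactPencils_of_lefschetzBCompactPencils algebraicQuasiInverseOfLefschetzStandard_holds
    fibreGysinKernelCompactPencils_holds fibreClassConstantCompactPencils_holds h₅

/-- **`(5) ⟹ (β′ᵖᵗ)`, kernel, no supply node** (CM-pointed compact pencils).
[cite: Andre1996Motifs, Lemme 6.3.1 (p. 31) and §6.3 Remarque 2 (p. 33)] -/
theorem LefschetzBCMPointedPencils.fibreClassLefschetzPointwiseCMPointedPencils (h₅ : LefschetzBCMPointedPencils) :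
    FibreClassLefschetzPointwiseCMPointedPencils :=
  fibreClassLefschetzPointwiseCMPointedPencils_of_lefschetzBCMPointedPencils algebraicQuasiInverseOfLefschetzStandard_holds
    fibreGysinKernelCompactPencils_holds h₅

/-- **`(5) ⟹ (β′)` — THE EDGE of the REFEREE-AB R-09/R-10 test case, KERNEL WITH NO SUPPLY NODE** (labels of record
`K[Q; κ, φ]` (part XI), `K[Q_H; φ]` (part XIII) now `K`): `B` for the total spaces of the CM-pointed compact abelian
pencils gives the algebraic quasi-inverse of the cup product with the fibre class on each of them.
[cite: Andre1996Motifs, Lemme 6.3.1 (p. 31) and §6.3 Remarque 2 (p. 33)] [cite: Abdulali1994FamiliesAV, Conjecture 5.3 (p. 1130)] -/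
theorem LefschetzBCMPointedPencils.fibreClassLefschetzOnCMPointedPencils (h₅ : LefschetzBCMPointedPencils) :
    FibreClassLefschetzOnCMPointedPencils :=
  fibreClassLefschetzOnCMPointedPencils_of_lefschetzBCMPointedPencils algebraicQuasiInverseOfLefschetzStandard_holds
    fibreGysinKernelCompactPencils_holds fibreClassConstantCompactPencils_holds h₅

/-- **Graded: `(5)_d ⟹ (β′)_d`, no supply node.** [cite: Andre1996Motifs, §6.3 Remarque 2 (p. 33)] -/
theorem LefschetzBCMPointedPencilsAtRelDim.fibreClassLefschetzOnAtRelDim {d : ℕ} (h₅ : LefschetzBCMPointedPencilsAtRelDim d) :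
    FibreClassLefschetzOnAtRelDim d :=
  fibreClassLefschetzOnAtRelDim_of_lefschetzBCMPointedPencilsAtRelDim algebraicQuasiInverseOfLefschetzStandard_holds
    fibreGysinKernelCompactPencils_holds fibreClassConstantCompactPencils_holds h₅

/-- Graded: `(5∀)_d ⟹ (β′)_d`, no supply node. [cite: Andre1996Motifs, §6.3 Remarque 2 (p. 33)] -/
theorem LefschetzBCompactPencilsAtRelDim.fibreClassLefschetzOnAtRelDim {d : ℕ} (h₅ : LefschetzBCompactPencilsAtRelDim d) :
    FibreClassLefschetzOnAtRelDim d :=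
  fibreClassLefschetzOnAtRelDim_of_lefschetzBCompactPencilsAtRelDim algebraicQuasiInverseOfLefschetzStandard_holds
    fibreGysinKernelCompactPencils_holds fibreClassConstantCompactPencils_holds h₅

/-! ## §3 The rung `d = 2` from Tankeev 2011 alone -/

/-- **`(β′)_2` FROM TANKEEV 2011 ALONE**: on every compact pencil of abelian SURFACES (total space a threefold of Kodaira
dimension `≤ 1`) the cup product with the fibre class has an ALGEBRAIC quasi-inverse in every degree `2p ≤ 4`, granted
only the Literature named fact `Tankeev2011_lefschetzStandard_abelianSurfacePencilThreefold` (`B` for these threefolds —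
Tankeev, Izv. Math. 75 (2011): `B(X)` for smooth complex projective threefolds with `κ(X) < 3`). Part XI's row modulo
(Q), (κ), (φ), `h_T`; now modulo `h_T` only. [cite: Tankeev2011, main theorem (κ(X) < 3)]
[cite: Tankeev2020, Introduction pp. 89–90] [cite: Andre1996Motifs, §6.3 Remarque 2 (p. 33)] -/
theorem fibreClassLefschetzOnAtRelDim_two_of_tankeev (hT : Tankeev2011_lefschetzStandard_abelianSurfacePencilThreefold) :
    FibreClassLefschetzOnAtRelDim 2 :=
  fibreClassLefschetzOnAtRelDim_two_of_tankeev2011 algebraicQuasiInverseOfLefschetzStandard_holds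
    fibreGysinKernelCompactPencils_holds fibreClassConstantCompactPencils_holds hT

/-- **`(β′)_d` for every `d ≤ 2` modulo `h_T` only** (`d ≤ 1` unconditional: `B` for curves and surfaces).
[cite: Tankeev2011, main theorem (κ(X) < 3)] [cite: GreenMurreVoisin1994, Murre §7.7 (PDF p. 123)] -/
theorem fibreClassLefschetzOnAtRelDim_of_le_two_of_tankeev (hT : Tankeev2011_lefschetzStandard_abelianSurfacePencilThreefold)
    {d : ℕ} (hd : d ≤ 2) : FibreClassLefschetzOnAtRelDim d :=
  fibreClassLefschetzOnAtRelDim_of_le_two_of_tankeev2011 algebraicQuasiInverseOfLefschetzStandard_holds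
    fibreGysinKernelCompactPencils_holds fibreClassConstantCompactPencils_holds hT hd

/-- **Granted `h_T` only, (β′) on CM-pointed compact pencils is EQUIVALENT to its restriction to relative dimension
`d ≥ 3`** (sevenfold total spaces and up are where the β-column is open). [cite: Tankeev2011, main theorem (κ(X) < 3)]
[cite: Andre1996Motifs, §6.3 Remarque 2 (p. 33)] -/
theorem fibreClassLefschetzOnCMPointedPencils_iff_forall_three_le_of_tankeev
    (hT : Tankeev2011_lefschetzStandard_abelianSurfacePencilThreefold) :
    FibreClassLefschetzOnCMPointedPencils ↔ ∀ d : ℕ, 3 ≤ d → FibreClassLefschetzOnAtRelDim d :=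
  fibreClassLefschetzOnCMPointedPencils_iff_forall_three_le_of_tankeev2011 algebraicQuasiInverseOfLefschetzStandard_holds
    fibreGysinKernelCompactPencils_holds fibreClassConstantCompactPencils_holds hT

/-! ## §4 The edge table with no supply binder -/

/-- **Part XI's edge table `lefschetzB_to_fibreClass_chain` with its three supply binders (Q), (κ), (φ) discharged**: each
arrow a closed theorem of the tree — `(5∀) ⟹ (β∀′ᵖᵗ)`, `(5∀) ⟹ (β∀′)`, `(5) ⟹ (β′ᵖᵗ)`, `(5) ⟹ (β′)`, `h_T ⟹ (β′)_2`.
[cite: Andre1996Motifs, §6.3 Remarque 2 (p. 33)] [cite: Tankeev2011, main theorem (κ(X) < 3)] -/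
theorem lefschetzB_to_fibreClass_chain_closed :
    (LefschetzBCompactPencils → FibreClassLefschetzPointwiseCompactPencils) ∧
      (LefschetzBCompactPencils → FibreClassLefschetzOnCompactPencils) ∧
      (LefschetzBCMPointedPencils → FibreClassLefschetzPointwiseCMPointedPencils) ∧
      (LefschetzBCMPointedPencils → FibreClassLefschetzOnCMPointedPencils) ∧
      (Tankeev2011_lefschetzStandard_abelianSurfacePencilThreefold → FibreClassLefschetzOnAtRelDim 2) :=
  ⟨LefschetzBCompactPencils.fibreClassLefschetzPointwiseCompactPencils,
    LefschetzBCompactPencils.fibreClassLefschetzOnCompactPencils,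
    LefschetzBCMPointedPencils.fibreClassLefschetzPointwiseCMPointedPencils,
    LefschetzBCMPointedPencils.fibreClassLefschetzOnCMPointedPencils, fibreClassLefschetzOnAtRelDim_two_of_tankeev⟩

end Summit.HodgeConjecture.HodgeConjecture.Ring2.AbelianAll

end
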